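import Summits.QuantumFields.BalabanUV.Beta.D1BFx.VectorLegEquation
import Summits.QuantumFields.BalabanUV.Beta.D1BFx.StencilKernels

/-!
# `BalabanUV.Beta.D1BFx.VectorLegKernelForm` — road «BF-x» for binder row D1, slot (K), `K-ASSEMBLY-SPEC.md` brick TB2 (N-side), part 1:
# X₁a IN KERNEL FORM — the (X₁a) operator as an EXPLICIT FIBRED ℤ⁴ KERNEL `X1aKer n a a′` (Laplacian ⊗ δ + `a′`·`Q̂ᵀQ̂` kernel − the four-point gauge term of `P`),
# its row action on bounded 1-forms, and **`compF (X1aKer (m+1) a (a/(m+1)⁸)) (GaF (m+1) a) = kdeltaF`** — the input of an4's∕leaf-03's Lemma 2.2.2 for the N-legs on tori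

HONEST FRAMING (cell contract, verbatim): «discharging `BetaPertH` makes Bałaban's UV stability UNCONDITIONAL — a real constructive-QFT
result; it is NOT the continuum limit and NOT the Clay problem.»  HONEST DEPENDENCY (verbatim): «continuum YM on T⁴ ⇐ BetaPertH ∧ nine
spine estimates (0/9 proved); BetaPertH ⇐ (D1) ∧ (D4) ∧ CAP+tail; G-an2-4 gates asym, D1 and NE2/3/4.»  THIS MODULE DISCHARGES NOTHING of
D1 / BetaPertH: [folklore] bookkeeping over this lineage's `VectorLegEquation.vectorLeg_equation` (X₁a), gan24-leaf-06-g28's `StencilKernels`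
(`codiff₁_dz_eq_tsum_lapKer`, `contourSumAdj_contourSum_eq_tsum`, `qqKer`), `HodgeIdentityForms.half_curvAdj_curv_add_dz_Rf_codiff₁`, B4's
`KernelFormOperators.Pf`, `ProjectorGaugeBlockConst.summable_Pgt_mul`, leaf-03-g7's `FibredPeriodisation` vocabulary (`FKer`, `compF`, `kdeltaF`) and
`GluonLeg` (`Ga`, `abs_Ga_le`).  Two data `def`s with bodies ([our object]: `X1aKer`, `GaF`); nothing is cited; 0 sorry.  NOT summit progress; NOT BetaPertH,
NOT continuum, NOT Clay.

ABSOLUTE RULE (cell, verbatim): «No internally-minted statement may enter as a cited fact. Every hypothesis is either kernel-proved in this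
package or a verbatim quotation of a PUBLISHED theorem with page reference. The manuscript(s) under audit are NOT citable for their own
disputed steps — they are the thing under adjudication; programme-internal (2001/route/tribunal) claims are never citable.»

WHY (`HOME/b2b-balaban-beta-d1-p2/K-ASSEMBLY-SPEC.md` v1 §1 TB2 «N-SIDE ON THE TORUS»).  On each cubic torus the R-weighted bordered system `N_T` of the
slice-transfer identity is inverted by finite Woodbury from the torus massive propagator, and the torus massive propagator is the PERIODISATION of
`Ga = K^∞` once `compF Δ^∞ Ga = δ` holds on `ℤ⁴` as a KERNEL identity (Lemma 2.2.2, `FibredPeriodisation.lemma222F`, with the row bound of `Ga` from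
the printed h12∕h126).  X₁a (`vectorLeg_equation`) is that identity in OPERATOR-ON-COLUMN form; this file writes the operator as the explicit kernel
`X1aKer` and restates X₁a as `compF X1aKer GaF = kdeltaF`.

CONTENT (block side `n ≥ 1`, `a > 0`, weight `a′`; all [folklore] / [our object]).
* §1 `X1aKer n a a′ : FKer 4 (Fin 4) (Fin 4)` — `((x,κ),(w,l)) ↦ [κ = l]·(lapKer x w + a′·qqKer n κ x w) − (P(x+e_κ, w+e_l) − P(x+e_κ, w) − P(x, w+e_l) + P(x, w))`,
  `P = Pgt n a`; `GaF n a : FKer 4 (Fin 4) (Fin 4)` — `((w,κ′),(y,l)) ↦ Ga n a w y κ′ l`.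
* §2 `Pf_codiff₁_eq` (`Pf (codiff₁ A) q = Σ_l Σ'_w (P(q, w+e_l) − P(q, w))·A l w` for bounded `A`), `dz_Pf_codiff₁_eq`, and
  **`X1aOp_eq_kernel`**: `½·curvAdj (curv A) κ x + dz (Rf n a (codiff₁ A)) κ x + a′·𝒬ᵀ𝒬A κ x = Σ_l Σ'_w X1aKer n a a′ (x,κ) (w,l) · A l w` (bounded `A`).
* §3 **`compF_X1aKer_GaF`**: `compF (X1aKer (m+1) a (a/(m+1)⁸)) (GaF (m+1) a) = kdeltaF` — X₁a in kernel form.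
Unit `b2b-balaban-beta-d1-p2` (road owner, gen 5).
-/

namespace Summit.QuantumFields.BalabanUV.Beta.D1BFx.VectorLegKernelForm

open Finset
open scoped BigOperators
open Literature.MathematicalPhysics.QuantumFieldTheory.Balaban1983to89
open Literature.MathematicalPhysics.QuantumFieldTheory.Balaban1983to89.Beta
open B5Prop11Lattice (gammaZero)
open AffineAveraging (Form0 Form1 unitVec dz curv curvAdj codiff₁ contourSum)
open AffineReproduction (contourSumAdj)
open B6QGQLower276 (X lapKer)
open Summit.QuantumFields.BalabanUV.Beta.D1BFx.RProjector (Pgt)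
open Summit.QuantumFields.BalabanUV.Beta.D1BFx.KernelFormOperators (kerOp Pf Rf)
open Summit.QuantumFields.BalabanUV.Beta.D1BFx.ProjectorGaugeBlockConst (summable_Pgt_mul)
open Summit.QuantumFields.BalabanUV.Beta.D1BFx.GluonLeg (Ga abs_Ga_le)
open Summit.QuantumFields.BalabanUV.Beta.D1BFx.StencilKernels (qqKer codiff₁_dz_eq_tsum_lapKer contourSumAdj_contourSum_eq_tsum)
open Summit.QuantumFields.BalabanUV.Beta.D1BFx.HodgeIdentityForms (half_curvAdj_curv_add_dz_Rf_codiff₁)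
open Summit.QuantumFields.BalabanUV.Beta.D1BFx.FibredPeriodisation (FKer compF kdeltaF)
open Summit.QuantumFields.BalabanUV.Beta.D1BFx.VectorLegEquation (vectorLeg_equation)

noncomputable section

variable (n : ℕ) [NeZero n] (a : ℝ)

/-! ## §1 The kernel of the (X₁a) operator and the gluon leg as fibred kernels -/

/-- [our object] **THE (X₁a) OPERATOR AS A FIBRED ℤ⁴ KERNEL**: `X1aKer n a a′ (x,κ) (w,l) = [κ = l]·(lapKer x w + a′·qqKer n κ x w)
− (P(x+e_κ, w+e_l) − P(x+e_κ, w) − P(x, w+e_l) + P(x, w))` — the componentwise Laplacian (`½·curvAdj∘curv + dz∘codiff₁`, Hodge), the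
averaging weight `𝒬ᵀ𝒬`, and the four-point gauge term `−dz∘Pf∘codiff₁` of the road's projector `P = Pgt n a`. -/
def X1aKer (a' : ℝ) : FKer 4 (Fin 4) (Fin 4) := fun i j =>
  (if i.2 = j.2 then lapKer i.1 j.1 + a' * qqKer n i.2 i.1 j.1 else 0)
    - (Pgt n a (i.1 + unitVec i.2) (j.1 + unitVec j.2) () () - Pgt n a (i.1 + unitVec i.2) j.1 () ()
        - Pgt n a i.1 (j.1 + unitVec j.2) () () + Pgt n a i.1 j.1 () ())

/-- [our object] **THE GLUON LEG AS A FIBRED KERNEL** (fibre second, as `Kinf`): `GaF n a (w,κ′) (y,l) = Ga n a w y κ′ l`. -/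
def GaF : FKer 4 (Fin 4) (Fin 4) := fun i j => Ga n a i.1 j.1 i.2 j.2

variable {n a}

omit [NeZero n] in
/-- [our object] Entries of `X1aKer`. -/
theorem X1aKer_apply (a' : ℝ) (x w : X 4) (κ l : Fin 4) :
    X1aKer n a a' (x, κ) (w, l) = (if κ = l then lapKer x w + a' * qqKer n κ x w else 0)
      - (Pgt n a (x + unitVec κ) (w + unitVec l) () () - Pgt n a (x + unitVec κ) w () ()
          - Pgt n a x (w + unitVec l) () () + Pgt n a x w () ()) := rfl

/-- [our object] Entries of `GaF`. -/
@[simp] theorem GaF_apply (w y : X 4) (κ' l : Fin 4) : GaF n a (w, κ') (y, l) = Ga n a w y κ' l := rfl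

/-! ## §2 The row action on bounded 1-forms -/

section Action

variable (n a)
variable {A : Form1 4 ℝ} {B : ℝ}

/-- [folklore] **`Pf` OF A CODIFFERENTIAL**: `Pf n a (codiff₁ A) q = Σ_l Σ'_w (P(q, w+e_l) − P(q, w))·A l w` for bounded `A` (shift `r = w + e_l` in the
absolutely convergent `P`-series). -/
theorem Pf_codiff₁_eq (ha : 0 < a) (hA : ∀ l w, |A l w| ≤ B) (q : X 4) :
    Pf n a (codiff₁ A) q = ∑ l, ∑' w : X 4, (Pgt n a q (w + unitVec l) () () - Pgt n a q w () ()) * A l w := by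
  simp only [Pf, KernelFormOperators.kerOp_apply, codiff₁]
  have hs1 : ∀ l, Summable fun r : X 4 => Pgt n a q r () () * A l (r - unitVec l) := fun l =>
    summable_Pgt_mul n a ha (fun r => hA l (r - unitVec l)) q
  have hs2 : ∀ l, Summable fun r : X 4 => Pgt n a q r () () * A l r := fun l => summable_Pgt_mul n a ha (fun r => hA l r) q
  have hs : ∀ l, Summable fun r : X 4 => Pgt n a q r () () * (A l (r - unitVec l) - A l r) := fun l => by
    simpa only [mul_sub] using (hs1 l).sub (hs2 l)
  rw [show (fun r : X 4 => Pgt n a q r () () * ∑ l, (A l (r - unitVec l) - A l r))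
      = fun r => ∑ l, Pgt n a q r () () * (A l (r - unitVec l) - A l r) from funext fun r => Finset.mul_sum _ _ _,
    Summable.tsum_finsetSum (fun l _ => hs l)]
  refine Finset.sum_congr rfl fun l _ => ?_
  have e1 : ∑' r : X 4, Pgt n a q r () () * A l (r - unitVec l) = ∑' w : X 4, Pgt n a q (w + unitVec l) () () * A l w := by
    rw [← (Equiv.addRight (unitVec l)).tsum_eq (fun r : X 4 => Pgt n a q r () () * A l (r - unitVec l))]
    exact tsum_congr fun w => by simp
  have hs3 : Summable fun w : X 4 => Pgt n a q (w + unitVec l) () () * A l w := by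
    have := (hs1 l).comp_injective (Equiv.addRight (unitVec l)).injective
    refine this.congr fun w => ?_
    simp
  calc ∑' r : X 4, Pgt n a q r () () * (A l (r - unitVec l) - A l r)
      = ∑' r : X 4, (Pgt n a q r () () * A l (r - unitVec l) - Pgt n a q r () () * A l r) := tsum_congr fun r => by ring
    _ = (∑' r : X 4, Pgt n a q r () () * A l (r - unitVec l)) - ∑' r : X 4, Pgt n a q r () () * A l r := (hs1 l).tsum_sub (hs2 l)
    _ = (∑' w : X 4, Pgt n a q (w + unitVec l) () () * A l w) - ∑' w : X 4, Pgt n a q w () () * A l w := by rw [e1]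
    _ = ∑' w : X 4, (Pgt n a q (w + unitVec l) () () * A l w - Pgt n a q w () () * A l w) := (hs3.tsum_sub (hs2 l)).symm
    _ = ∑' w : X 4, (Pgt n a q (w + unitVec l) () () - Pgt n a q w () ()) * A l w := tsum_congr fun w => by ring

/-- [folklore] **THE GAUGE TERM `dz (Pf (codiff₁ A))` AS A FOUR-POINT ROW ACTION** (bounded `A`). -/
theorem dz_Pf_codiff₁_eq (ha : 0 < a) (hA : ∀ l w, |A l w| ≤ B) (κ : Fin 4) (x : X 4) :
    dz (Pf n a (codiff₁ A)) κ x
      = ∑ l, ∑' w : X 4, (Pgt n a (x + unitVec κ) (w + unitVec l) () () - Pgt n a (x + unitVec κ) w () ()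
          - Pgt n a x (w + unitVec l) () () + Pgt n a x w () ()) * A l w := by
  simp only [dz]
  rw [Pf_codiff₁_eq n a ha hA, Pf_codiff₁_eq n a ha hA, ← Finset.sum_sub_distrib]
  refine Finset.sum_congr rfl fun l _ => ?_
  have hs : ∀ q : X 4, Summable fun w : X 4 => (Pgt n a q (w + unitVec l) () () - Pgt n a q w () ()) * A l w := by
    intro q
    have h1 : Summable fun w : X 4 => Pgt n a q (w + unitVec l) () () * A l w := by
      have := (summable_Pgt_mul n a ha (fun r => hA l (r - unitVec l)) q).comp_injective (Equiv.addRight (unitVec l)).injective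
      refine this.congr fun w => ?_
      simp
    have h2 : Summable fun w : X 4 => Pgt n a q w () () * A l w := summable_Pgt_mul n a ha (fun r => hA l r) q
    simpa only [sub_mul] using h1.sub h2
  rw [← (hs (x + unitVec κ)).tsum_sub (hs x)]
  exact tsum_congr fun w => by ring

/-- [folklore] **THE (X₁a) OPERATOR IS THE ROW ACTION OF `X1aKer`** on bounded 1-forms:
`½·curvAdj (curv A) κ x + dz (Rf n a (codiff₁ A)) κ x + a′·𝒬ᵀ𝒬A κ x = Σ_l Σ'_w X1aKer n a a′ (x,κ) (w,l)·A l w`. -/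
theorem X1aOp_eq_kernel (ha : 0 < a) (a' : ℝ) (hA : ∀ l w, |A l w| ≤ B) (κ : Fin 4) (x : X 4) :
    (1 / 2 : ℝ) * curvAdj (curv A) κ x + dz (Rf n a (codiff₁ A)) κ x + a' * contourSumAdj n (contourSum n A) κ x
      = ∑ l, ∑' w : X 4, X1aKer n a a' (x, κ) (w, l) * A l w := by
  rw [half_curvAdj_curv_add_dz_Rf_codiff₁, codiff₁_dz_eq_tsum_lapKer, contourSumAdj_contourSum_eq_tsum, dz_Pf_codiff₁_eq n a ha hA]
  -- summabilities of the three pieces of the row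
  have hsL : Summable fun w : X 4 => lapKer x w * A κ w := by
    refine summable_of_ne_finset_zero (s := B5Hk103ScalarZd.nbhd (n - 1) x) fun w hw => ?_
    rw [B5Hk103ScalarZd.lapKer_eq_zero_of_not_mem hw, zero_mul]
  have hsQ : Summable fun w : X 4 => qqKer n κ x w * A κ w := by
    refine summable_of_ne_finset_zero
      (s := ((Finset.range n ×ˢ AffineAveraging.box 4 n) ×ˢ Finset.range n).image
        (fun t : (ℕ × (Fin 4 → ℕ)) × ℕ => (n : ℤ) • AveragingContours.blk n (x - (t.1.1 : ℤ) • unitVec κ) + AffineAveraging.toSite t.1.2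
          + (t.2 : ℤ) • unitVec κ)) fun w hw => ?_
    rw [StencilKernels.qqKer_eq_zero_of_not_mem n κ x w hw, zero_mul]
  have hsP : ∀ l, Summable fun w : X 4 => (Pgt n a (x + unitVec κ) (w + unitVec l) () () - Pgt n a (x + unitVec κ) w () ()
      - Pgt n a x (w + unitVec l) () () + Pgt n a x w () ()) * A l w := by
    intro l
    have hsh : ∀ q : X 4, Summable fun w : X 4 => Pgt n a q (w + unitVec l) () () * A l w := fun q => by
      have := (summable_Pgt_mul n a ha (fun r => hA l (r - unitVec l)) q).comp_injective (Equiv.addRight (unitVec l)).injective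
      refine this.congr fun w => ?_
      simp
    have h0 : ∀ q : X 4, Summable fun w : X 4 => Pgt n a q w () () * A l w := fun q => summable_Pgt_mul n a ha (fun r => hA l r) q
    have := ((hsh (x + unitVec κ)).sub (h0 (x + unitVec κ))).sub ((hsh x).sub (h0 x))
    refine this.congr fun w => ?_
    ring
  -- the `if κ = l` row contributes only at `l = κ`
  have hite : ∑ l, ∑' w : X 4, (if κ = l then lapKer x w + a' * qqKer n κ x w else 0) * A l w
      = ∑' w : X 4, lapKer x w * A κ w + a' * ∑' w : X 4, qqKer n κ x w * A κ w := by
    rw [Finset.sum_eq_single κ (fun l _ hl => by simp [Ne.symm hl]) (fun h => (h (Finset.mem_univ κ)).elim)]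
    simp only [if_true]
    rw [← tsum_mul_left, ← hsL.tsum_add (hsQ.mul_left a')]
    exact tsum_congr fun w => by ring
  have hsplit : ∀ l, ∑' w : X 4, X1aKer n a a' (x, κ) (w, l) * A l w
      = (∑' w : X 4, (if κ = l then lapKer x w + a' * qqKer n κ x w else 0) * A l w)
        - ∑' w : X 4, (Pgt n a (x + unitVec κ) (w + unitVec l) () () - Pgt n a (x + unitVec κ) w () ()
            - Pgt n a x (w + unitVec l) () () + Pgt n a x w () ()) * A l w := by
    intro l
    have hsI : Summable fun w : X 4 => (if κ = l then lapKer x w + a' * qqKer n κ x w else 0) * A l w := by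
      by_cases h : κ = l
      · subst h; simp only [if_true]; simpa only [add_mul, mul_assoc] using hsL.add (hsQ.mul_left a')
      · simp [h]
    rw [← hsI.tsum_sub (hsP l)]
    exact tsum_congr fun w => by rw [X1aKer_apply]; ring
  rw [Finset.sum_congr rfl fun l _ => hsplit l, Finset.sum_sub_distrib, hite]
  ring

end Action

/-! ## §3 X₁a in kernel form -/

/-- [folklore] **X₁a IN KERNEL FORM**: `compF (X1aKer (m+1) a (a/(m+1)⁸)) (GaF (m+1) a) = kdeltaF` — the R-weighted vector operator's kernel composed with
the gluon leg `Ga = K^∞` is the identity kernel on `ℤ⁴ × Fin 4` (`VectorLegEquation.vectorLeg_equation`, read through `X1aOp_eq_kernel` on the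
bounded columns of `Ga`). -/
theorem compF_X1aKer_GaF (m : ℕ) (ha : 0 < a) :
    compF (X1aKer (m + 1) a (a / ((m + 1 : ℕ) : ℝ) ^ 8)) (GaF (m + 1) a) = kdeltaF := by
  funext i j
  obtain ⟨x, κ⟩ := i
  obtain ⟨y, l⟩ := j
  have hA : ∀ κ' w, |Ga (m + 1) a w y κ' l| ≤ (((m + 1 : ℕ) : ℕ) : ℝ) ^ 2 * (gammaZero 4 a)⁻¹ := fun κ' w =>
    abs_Ga_le (m + 1) a (Nat.succ_le_succ (Nat.zero_le m)) ha w y κ' l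
  have h := vectorLeg_equation m a ha l y κ x
  rw [X1aOp_eq_kernel (m + 1) a ha _ hA] at h
  simp only [compF, GaF_apply, kdeltaF, Prod.mk.injEq]
  rw [h]

end

end Summit.QuantumFields.BalabanUV.Beta.D1BFx.VectorLegKernelForm
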